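import Summits.Ventures.YMGap.RobustBall.LangevinPoincareLimit
import Summits.Ventures.YMGap.Thresholds.TwistedBochnerIntegrated
import Summits.Ventures.YMGap.Thresholds.OneLinkModulusSU3Twisted
import HarnessLib

/-!
# Robust ball (Y2) — the Langevin Poincaré inequality on the Kantorovich–Rubinstein window with the TWISTED (dimensional) one-link constant:
# `SU(2)` gap `≥ (1 − 9β_W/2)·(3/2)(1 − 3β_W/2 − 9β_W²/16)`, sharp at `β = 0`

HONEST FRAMING: venture file of the cell `pub-ymgap` (QuantumFields programme), track ROBUST-BALL, seat rb-p2 (g13); a CONSTANT upgrade of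
`LangevinPoincare.lean` (same window, same currency `LatticeBakryEmery.Gam`): the one-link step uses engine-2's TWISTED (dimensional) integrated Bochner
inequality `TwistedBochner.integral_exp_mul_Gam_le_twisted_sun` (every `N ≥ 2`; one-link curvature constant
`K_tw = ((N²−1)/(N²−2))·(N/2 − (N − 2/N)‖B‖_op − ‖B‖_F²/(2N²))` instead of Bakry–Émery's `N/2 − N‖B‖_op`; at `B = 0`, `N = 2` this is `3/2 =` the sharp
spectral gap of the Haar measure on `SU(2) = S³` by Lichnerowicz) through pub-balaban's `poincare_pot_K`.  LATTICE statements at STRONG COUPLING, Wilson action,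
`d = 4` torus, uniformly in the volume; nothing about `β → ∞`, the continuum or Clay.
* `section_variance_le_twisted` — one-link twisted Poincaré for the section of a smooth `f`: `K · Var_{ν_B}(g ↦ f(c[i ↦ g])) ≤ ∫ (link-i block of Γ(f,f)) dν_B`
  for `K ≤ K_tw(N, R)`, `‖B‖_op ≤ R`.
* ★★★ `variance_le_integral_Gam_twisted` — `d = 4`, `OneLinkKRModulus N R K`, `c = 18(|β|/N)K < 1`, `R₁ = 6|β|/N`,
  `K₀ := ((N²−1)/(N²−2))(N/2 − (N − 2/N)R₁ − R₁²/(2N)) > 0`: `Var_{μ_{β,L}}(f) ≤ ((1 − c)K₀)⁻¹ ∫ Γ(f,f) dμ_{β,L}` on every torus of side `≥ 2`.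
* ★★★ `su2_variance_le_integral_Gam_twisted` — `SU(2)`, HYPOTHESIS-FREE on `0 ≤ β_W < 2/9`: `Var_μ(f) ≤ ((1 − 9β_W/2)·(3/2)(1 − 3β_W/2 − 9β_W²/16))⁻¹ ∫ Γ(f,f) dμ`
  — Langevin gap (standard reading) `≥ (1 − 9β_W/2)(3/2)(1 − 3β_W/2 − 9β_W²/16)`: `0.527` at `β_W = 1/8` (Bakry–Émery one-link step, `LangevinPoincare`:
  `0.273`; the venture's multi-link Bakry–Émery file: `0`), `→ 3/2` as `β_W → 0` (sharp), `0.102` at `β_W = 1/5` (BE step: `0.040`); the one-link factor alone is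
  `(3/2)(1 − 3β_W/2 − 9β_W²/16)` vs `1 − 3β_W`: `1.93×` at `1/8`, `2.54×` at `1/5`.
* ★★ `su3_variance_le_integral_Gam_twisted` — `SU(3)`, HYPOTHESIS-FREE on `0 ≤ β_W < 1000/3531` (engine-2's twisted KR modulus): constant
  `((1 − 3531β_W/1000)(8/7)(3/2 − 14β_W/9 − 2β_W²/27))⁻¹` (gap `→ 12/7` at `β_W → 0`).
* ★★★ `su2_limit_variance_le_integral_Gam_twisted` — the same constant for EVERY infinite-volume (tight) limit state and every smooth cylinder function
  (`LangevinPoincareLimit`'s passage to the limit).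
0 sorry, 0 definitions.  References: A. Lichnerowicz (1958); D. Bakry, M. Émery (1985); H. Shen, R. Zhu, X. Zhu, CMP 400 (2023); cell files
`TwistedBochnerSUN/SU3/Integrated` (engine-2), `StrongCouplingDimensionalPoincare` (pub-balaban).  Everything here is proved. [folklore]
-/

noncomputable section

open scoped Matrix ComplexConjugate BigOperators Matrix.Norms.Frobenius ContDiff Topology ProbabilityTheory
open Matrix Complex Finset MeasureTheory Filter ProbabilityTheory Function Real
open Literature.MathematicalPhysics.QuantumFieldTheory
open Literature.MathematicalPhysics.QuantumLattice (fundamentalRep continuous_fundamentalRep infiniteVolumeLimitPoints)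
open Literature.MathematicalPhysics.QuantumFieldTheory.SUNBakryEmery (SUN FrameIdx frame haarSU pot)
open Literature.MathematicalPhysics.QuantumFieldTheory.Balaban1983to89.StrongCouplingTorusWindow (tField matrixOpNorm_tField_le)
open Literature.MathematicalPhysics.QuantumFieldTheory.Balaban1983to89.StrongCouplingDobrushinWindow (OneLinkKRModulus)
open Summit.Ventures.YMGap.LatticeBakryEmery
open Summit.QuantumFields.YangMills.Theorems.StrongPinningPoincare
open Summit.QuantumFields.BalabanUV.InfraRed.StrongCouplingDimensionalPoincare (poincare_pot_K)
open Summit.Ventures.YMGap.TwistedBochner (integral_exp_mul_Gam_le_twisted_sun)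
open Summit.Ventures.YMGap.OneLinkEigen (frobNorm_le_sqrt_mul_matrixOpNorm)
open Summit.Ventures.YMGap.RobustBall.HeatBathPoincare (heatBathPoincare_of_oneLinkKRModulus heatBath_eq_tilted_tField)

namespace Summit.Ventures.YMGap.RobustBall.LangevinPoincare

universe u

/-! ### The twisted one-link constant -/

section OneLink

variable {ι : Type u} [Fintype ι] [DecidableEq ι] {N : ℕ}

/-- **One-link TWISTED Poincaré inequality for a section**: for `N ≥ 2`, `‖B‖_op ≤ R`, `0 < K ≤ ((N²−1)/(N²−2))(N/2 − (N − 2/N)R − R²/(2N))` and smooth `f`,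
`K · Var_{ν_B}(g ↦ f(c[i ↦ g])) ≤ ∫ ∑_α (D_{single_i Y_α} f (c[i ↦ g]))² dν_B(g)` (engine-2's integrated twisted Bochner inequality through pub-balaban's
`poincare_pot_K`; `‖B‖_F² ≤ N‖B‖_op²`). [folklore] -/
theorem section_variance_le_twisted (hN : 2 ≤ N) {f : Cfg ι N → ℝ} (hf : ContDiff ℝ ∞ f) (c : Cfg ι N) (i : ι)
    (B : Matrix (Fin N) (Fin N) ℂ) {R K : ℝ} (hB : matrixOpNorm B ≤ R) (hK : 0 < K)
    (hKle : K ≤ ((N : ℝ) ^ 2 - 1) / ((N : ℝ) ^ 2 - 2) * ((N : ℝ) / 2 - ((N : ℝ) - 2 / N) * R - R ^ 2 / (2 * N))) :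
    K * Var[fun g : SUN N => f (update c i (g : Matrix (Fin N) (Fin N) ℂ));
          (haarSU N).tilted fun g : SUN N => (N : ℝ) * ((g : Matrix (Fin N) (Fin N) ℂ) * B).trace.re] ≤
      ∫ g : SUN N, ∑ α : FrameIdx N, algD (lk i (frame α)) f (update c i (g : Matrix (Fin N) (Fin N) ℂ)) ^ 2
        ∂((haarSU N).tilted fun g : SUN N => (N : ℝ) * ((g : Matrix (Fin N) (Fin N) ℂ) * B).trace.re) := by
  have hN0 : N ≠ 0 := by omega
  have hN2 : (2 : ℝ) ≤ N := by exact_mod_cast hN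
  have hNpos : (0 : ℝ) < N := by positivity
  have hn2 : 0 < (N : ℝ) ^ 2 - 2 := by nlinarith
  have hop : 0 ≤ matrixOpNorm B := matrixOpNorm_nonneg B
  set u : Matrix (Fin N) (Fin N) ℂ → ℝ := fun P => f (update c i P) with hu_def
  have hu : ContDiff ℝ ∞ u := contDiff_section hf c i
  -- the pointwise twisted constant dominates `K`
  have hF : frobNorm B ^ 2 ≤ (N : ℝ) * matrixOpNorm B ^ 2 := by
    have h := frobNorm_le_sqrt_mul_matrixOpNorm B
    have h' := pow_le_pow_left₀ (frobNorm_nonneg B) h 2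
    rw [mul_pow, Real.sq_sqrt hNpos.le] at h'
    exact h'
  have hF' : frobNorm B ^ 2 ≤ (N : ℝ) * R ^ 2 := hF.trans (mul_le_mul_of_nonneg_left (pow_le_pow_left₀ hop hB 2) hNpos.le)
  have hKle' : K ≤ ((N : ℝ) ^ 2 - 1) / ((N : ℝ) ^ 2 - 2) *
      ((N : ℝ) / 2 - (1 - 2 / (N : ℝ) ^ 2) * (|(N : ℝ)| * matrixOpNorm B) - (N : ℝ) ^ 2 * frobNorm B ^ 2 / (2 * (N : ℝ) ^ 4)) := by
    rw [abs_of_pos hNpos]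
    have hc1 : 0 ≤ (N : ℝ) - 2 / N := by rw [sub_nonneg, div_le_iff₀ hNpos]; nlinarith
    have h1 : ((N : ℝ) - 2 / N) * matrixOpNorm B ≤ ((N : ℝ) - 2 / N) * R := mul_le_mul_of_nonneg_left hB hc1
    have h2 : frobNorm B ^ 2 / (2 * (N : ℝ) ^ 2) ≤ (N : ℝ) * R ^ 2 / (2 * (N : ℝ) ^ 2) := div_le_div_of_nonneg_right hF' (by positivity)
    have e1 : (1 - 2 / (N : ℝ) ^ 2) * ((N : ℝ) * matrixOpNorm B) = ((N : ℝ) - 2 / N) * matrixOpNorm B := by field_simp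
    have e2 : (N : ℝ) ^ 2 * frobNorm B ^ 2 / (2 * (N : ℝ) ^ 4) = frobNorm B ^ 2 / (2 * (N : ℝ) ^ 2) := by field_simp
    have e3 : (N : ℝ) * R ^ 2 / (2 * (N : ℝ) ^ 2) = R ^ 2 / (2 * N) := by field_simp
    rw [e1, e2]
    have hr : 0 ≤ ((N : ℝ) ^ 2 - 1) / ((N : ℝ) ^ 2 - 2) := div_nonneg (by nlinarith) hn2.le
    refine hKle.trans (mul_le_mul_of_nonneg_left ?_ hr)
    rw [← e3]; linarith
  have hGam : ∀ {v : Matrix (Fin N) (Fin N) ℂ → ℝ}, ContDiff ℝ ∞ v →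
      K * ∫ g : SUN N, Real.exp (pot (N : ℝ) B g) * SUNBakryEmery.Gam v v g ∂(haarSU N) ≤
        ∫ g : SUN N, Real.exp (pot (N : ℝ) B g) * SUNBakryEmery.genL (pot (N : ℝ) B) v g ^ 2 ∂(haarSU N) := by
    intro v hv
    have h := integral_exp_mul_Gam_le_twisted_sun hN (N : ℝ) B hv
    have hI : 0 ≤ ∫ g : SUN N, Real.exp (pot (N : ℝ) B g) * SUNBakryEmery.Gam v v g ∂(haarSU N) :=
      integral_nonneg fun g => mul_nonneg (Real.exp_pos _).le (SUNBakryEmery.Gam_self_nonneg _ _)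
    exact (mul_le_mul_of_nonneg_right hKle' hI).trans h
  have hP := poincare_pot_K hN0 (N : ℝ) B hK hGam hu
  -- normalise (as in `section_variance_le`)
  rw [show (fun g : SUN N => (N : ℝ) * ((g : Matrix (Fin N) (Fin N) ℂ) * B).trace.re) = fun g : SUN N => pot (N : ℝ) B g from rfl]
  set ν : Measure (SUN N) := (haarSU N).tilted fun g : SUN N => pot (N : ℝ) B g with hν
  have hwc : Continuous fun g : SUN N => Real.exp (pot (N : ℝ) B g) :=
    Real.continuous_exp.comp (SUNBakryEmery.continuous_restrict (SUNBakryEmery.contDiff_pot _ B))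
  set Z : ℝ := ∫ g, Real.exp (pot (N : ℝ) B g) ∂(haarSU N) with hZ
  have hZpos : 0 < Z := integral_exp_pos (SUNBakryEmery.integrable_of_continuous_SUN hwc _)
  haveI : IsProbabilityMeasure ν := isProbabilityMeasure_tilted (SUNBakryEmery.integrable_of_continuous_SUN hwc _)
  have hψc : Continuous fun g : SUN N => u (g : Matrix (Fin N) (Fin N) ℂ) := SUNBakryEmery.continuous_restrict hu
  set m : ℝ := (∫ g : SUN N, Real.exp (pot (N : ℝ) B g) * u g ∂(haarSU N)) / Z with hm
  have hmean : ∫ g, u (g : Matrix (Fin N) (Fin N) ℂ) ∂ν = m := SUNBakryEmery.integral_tilted_eq_div _ _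
  have hvar : Var[fun g : SUN N => u (g : Matrix (Fin N) (Fin N) ℂ); ν] =
      (∫ g : SUN N, Real.exp (pot (N : ℝ) B g) * (u g - m) ^ 2 ∂(haarSU N)) / Z := by
    rw [variance_eq_integral hψc.measurable.aemeasurable]
    simp only [hmean]
    exact SUNBakryEmery.integral_tilted_eq_div _ _
  have hG : ∫ g : SUN N, ∑ α : FrameIdx N, algD (lk i (frame α)) f (update c i (g : Matrix (Fin N) (Fin N) ℂ)) ^ 2 ∂ν =
      (∫ g : SUN N, Real.exp (pot (N : ℝ) B g) * SUNBakryEmery.Gam u u g ∂(haarSU N)) / Z := by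
    rw [SUNBakryEmery.integral_tilted_eq_div]
    congr 1
    refine integral_congr_ae (ae_of_all _ fun g => ?_)
    simp only [hu_def]
    rw [gam_section hf c i]
  show K * Var[fun g : SUN N => u (g : Matrix (Fin N) (Fin N) ℂ); ν] ≤ _
  rw [hvar, hG, ← mul_div_assoc]
  exact div_le_div_of_nonneg_right hP hZpos.le

end OneLink

/-! ### The torus: the Langevin Poincaré inequality with the twisted one-link constant -/

section Main

variable {N L : ℕ} [NeZero L]

/-- **Conditional variance in one link ≤ K₀⁻¹ × link block**, twisted constant (`d = 4`, torus side `≥ 2`, `N ≥ 2`): with `R₁ = 6|β|/N ≥ ‖B_U‖_op` and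
`K₀ = ((N²−1)/(N²−2))(N/2 − (N − 2/N)R₁ − R₁²/(2N)) > 0`, `Var_{ν_ℓ^U}(g ↦ f(U[ℓ ↦ g])) ≤ K₀⁻¹ ∫ (block) dν_ℓ^U`. [folklore] -/
theorem condVariance_le_twisted (hN : 2 ≤ N) (β : ℝ)
    (hK₀ : 0 < ((N : ℝ) ^ 2 - 1) / ((N : ℝ) ^ 2 - 2) * ((N : ℝ) / 2 - ((N : ℝ) - 2 / N) * (|β| / N * 6) - (|β| / N * 6) ^ 2 / (2 * N)))
    (hL : 1 < L) {f : Cfg (Edge 4 L) N → ℝ} (hf : ContDiff ℝ ∞ f) (ℓ : Edge 4 L) (U : GaugeConfig 4 L (SUN N)) :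
    ∫ g, (f (emb (update U ℓ g)) - ∫ g', f (emb (update U ℓ g'))
        ∂((haarProbability (SUN N)).tilted fun g'' => -β * wilsonAction (fundamentalRep (Fin N)) (update U ℓ g''))) ^ 2
        ∂((haarProbability (SUN N)).tilted fun g'' => -β * wilsonAction (fundamentalRep (Fin N)) (update U ℓ g'')) ≤
      (((N : ℝ) ^ 2 - 1) / ((N : ℝ) ^ 2 - 2) * ((N : ℝ) / 2 - ((N : ℝ) - 2 / N) * (|β| / N * 6) - (|β| / N * 6) ^ 2 / (2 * N)))⁻¹ *
        ∫ g, ∑ α : FrameIdx N, algD (lk ℓ (frame α)) f (emb (update U ℓ g)) ^ 2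
          ∂((haarProbability (SUN N)).tilted fun g'' => -β * wilsonAction (fundamentalRep (Fin N)) (update U ℓ g'')) := by
  have hN1 : 1 ≤ N := by omega
  rw [heatBath_eq_tilted_tField hL hN1 β ℓ U]
  set B := tField β ℓ U with hBdef
  have hB : matrixOpNorm B ≤ |β| / N * 6 := by
    have h := matrixOpNorm_tField_le (d := 4) (L := L) (by norm_num) hN1 β ℓ U
    norm_num at h
    linarith
  set K₀ : ℝ := ((N : ℝ) ^ 2 - 1) / ((N : ℝ) ^ 2 - 2) * ((N : ℝ) / 2 - ((N : ℝ) - 2 / N) * (|β| / N * 6) - (|β| / N * 6) ^ 2 / (2 * N)) with hK₀def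
  have hsec := section_variance_le_twisted hN hf (emb U) ℓ B hB hK₀ le_rfl
  simp_rw [emb_update]
  set ν : Measure (SUN N) := (haarSU N).tilted fun g : SUN N => (N : ℝ) * ((g : Matrix (Fin N) (Fin N) ℂ) * B).trace.re with hν
  have hwc : Continuous fun g : SUN N => Real.exp (pot (N : ℝ) B g) :=
    Real.continuous_exp.comp (SUNBakryEmery.continuous_restrict (SUNBakryEmery.contDiff_pot _ B))
  haveI : IsProbabilityMeasure ν := isProbabilityMeasure_tilted (SUNBakryEmery.integrable_of_continuous_SUN hwc _)
  have hψc : Continuous fun g : SUN N => f (update (emb U) ℓ (g : Matrix (Fin N) (Fin N) ℂ)) :=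
    SUNBakryEmery.continuous_restrict (contDiff_section hf (emb U) ℓ)
  have hvar : Var[fun g : SUN N => f (update (emb U) ℓ (g : Matrix (Fin N) (Fin N) ℂ)); ν] = ∫ g, (f (update (emb U) ℓ
      (g : Matrix (Fin N) (Fin N) ℂ)) - ∫ g', f (update (emb U) ℓ (g' : Matrix (Fin N) (Fin N) ℂ)) ∂ν) ^ 2 ∂ν :=
    variance_eq_integral hψc.measurable.aemeasurable
  show ∫ g, (f (update (emb U) ℓ (g : Matrix (Fin N) (Fin N) ℂ)) - ∫ g', f (update (emb U) ℓ (g' : Matrix (Fin N) (Fin N) ℂ)) ∂ν) ^ 2 ∂ν ≤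
    K₀⁻¹ * ∫ g, ∑ α : FrameIdx N, algD (lk ℓ (frame α)) f (update (emb U) ℓ (g : Matrix (Fin N) (Fin N) ℂ)) ^ 2 ∂ν
  rw [← hvar, ← div_eq_inv_mul, le_div_iff₀ hK₀, mul_comm]
  exact hsec

/-- ★★★ **THE LANGEVIN POINCARÉ INEQUALITY ON THE KANTOROVICH–RUBINSTEIN WINDOW WITH THE TWISTED ONE-LINK CONSTANT** (`d = 4`, `N ≥ 2`, tree coupling `β`,
every torus side `L ≥ 2`): if `(|β|/N)·6 ≤ R`, `OneLinkKRModulus N R K`, `18 (|β|/N) K ≤ c < 1` and, with `R₁ = 6|β|/N`,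
`K₀ := ((N²−1)/(N²−2))(N/2 − (N − 2/N)R₁ − R₁²/(2N)) > 0`, then for every smooth `f` of the link matrices
`Var_{μ_{β,L}}(f) ≤ ((1 − c)K₀)⁻¹ ∫ Γ(f,f) dμ_{β,L}` (the Bakry–Émery one-link step of `variance_le_integral_Gam_of_oneLinkKRModulus` gives `N/2 − 6|β|` for `K₀`). [folklore] -/
theorem variance_le_integral_Gam_twisted (hN : 2 ≤ N) {β R K c : ℝ} (hK : 0 ≤ K) (hR : |β| / N * 6 ≤ R)
    (hmod : OneLinkKRModulus N R K) (hc : 18 * (|β| / N) * K ≤ c) (hc1 : c < 1)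
    (hK₀ : 0 < ((N : ℝ) ^ 2 - 1) / ((N : ℝ) ^ 2 - 2) * ((N : ℝ) / 2 - ((N : ℝ) - 2 / N) * (|β| / N * 6) - (|β| / N * 6) ^ 2 / (2 * N)))
    (hL : 1 < L) {f : Cfg (Edge 4 L) N → ℝ} (hf : ContDiff ℝ ∞ f) :
    Var[fun U => f (emb U); wilsonMeasure (d := 4) (L := L) (fundamentalRep (Fin N)) β] ≤
      ((1 - c) * (((N : ℝ) ^ 2 - 1) / ((N : ℝ) ^ 2 - 2) * ((N : ℝ) / 2 - ((N : ℝ) - 2 / N) * (|β| / N * 6) - (|β| / N * 6) ^ 2 / (2 * N))))⁻¹ *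
        ∫ U, Gam f f (emb U) ∂(wilsonMeasure (d := 4) (L := L) (fundamentalRep (Fin N)) β) := by
  classical
  haveI : SecondCountableTopology (Matrix (Fin N) (Fin N) ℂ) := inferInstanceAs (SecondCountableTopology (Fin N → Fin N → ℂ))
  haveI : SecondCountableTopology (SUN N) := Topology.IsEmbedding.subtypeVal.secondCountableTopology
  have hN1 : 1 ≤ N := by omega
  have hρc := continuous_fundamentalRep (Fin N)
  set K₀ : ℝ := ((N : ℝ) ^ 2 - 1) / ((N : ℝ) ^ 2 - 2) * ((N : ℝ) / 2 - ((N : ℝ) - 2 / N) * (|β| / N * 6) - (|β| / N * 6) ^ 2 / (2 * N)) with hK₀def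
  set μ : Measure (GaugeConfig 4 L (SUN N)) := wilsonMeasure (d := 4) (L := L) (fundamentalRep (Fin N)) β with hμdef
  haveI : IsProbabilityMeasure μ := isProbabilityMeasure_wilsonMeasure (d := 4) (L := L) (fundamentalRep (Fin N)) hρc β
  have hc0 : 0 < 1 - c := by linarith
  have hbdd : ∀ {φ : GaugeConfig 4 L (SUN N) → ℝ}, Continuous φ → ∃ M : ℝ, ∀ U, |φ U| ≤ M := fun hφ => by
    obtain ⟨C, hC⟩ := (isCompact_univ (X := GaugeConfig 4 L (SUN N))).exists_bound_of_continuousOn hφ.continuousOn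
    exact ⟨C, fun U => by simpa [Real.norm_eq_abs] using hC U (Set.mem_univ _)⟩
  set F : GaugeConfig 4 L (SUN N) → ℝ := fun U => f (emb U) with hFdef
  have hFc : Continuous F := hf.continuous.comp continuous_emb
  have hFm : Measurable F := hFc.measurable
  obtain ⟨M, hM⟩ := hbdd hFc
  have hHB := heatBathPoincare_of_oneLinkKRModulus hN1 hK hR hmod hc hc1 hL F hFm ⟨M, hM⟩
  set V : GaugeConfig 4 L (SUN N) → ℝ := fun U => -β * wilsonAction (fundamentalRep (Fin N)) U with hV
  have hVm : Measurable V := (measurable_wilsonAction (fundamentalRep (Fin N)) hρc).const_mul _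
  obtain ⟨B₁, hB₁⟩ := exists_abs_wilsonAction_le (d := 4) (L := L) (G := SUN N) (fundamentalRep (Fin N)) hρc
  have hVb : ∀ U, |V U| ≤ |β| * B₁ := fun U => by
    simp only [hV, abs_mul, abs_neg]
    exact mul_le_mul_of_nonneg_left (hB₁ U) (abs_nonneg _)
  have hμ : μ = (Measure.pi fun _ : Edge 4 L => haarProbability (SUN N)).tilted V :=
    Literature.MathematicalPhysics.QuantumLattice.wilsonMeasure_eq_tilted_pi (fundamentalRep (Fin N)) hρc β
  have hblkc : ∀ ℓ : Edge 4 L, Continuous fun U : GaugeConfig 4 L (SUN N) => ∑ α : FrameIdx N, algD (lk ℓ (frame α)) f (emb U) ^ 2 :=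
    fun ℓ => continuous_finsetSum _ fun α _ => ((contDiff_algD hf _).continuous.comp continuous_emb).pow 2
  have key : ∀ ℓ : Edge 4 L,
      ∫ U, ∫ g, (F U - F (update U ℓ g)) ^ 2 ∂((haarProbability (SUN N)).tilted fun g' => V (update U ℓ g')) ∂μ ≤
        2 * K₀⁻¹ * ∫ U, ∑ α : FrameIdx N, algD (lk ℓ (frame α)) f (emb U) ^ 2 ∂μ := by
    intro ℓ
    obtain ⟨Mb, hMb⟩ := hbdd (hblkc ℓ)
    rw [hμ, dirichlet_eq_two_mul_condVariance (haarProbability (SUN N)) hVm hVb ℓ hFm hM, ← hμ, mul_assoc]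
    refine mul_le_mul_of_nonneg_left ?_ (by norm_num)
    have hDLR := HeatBath.integral_heatBath (haarProbability (SUN N)) hVm hVb ℓ (hblkc ℓ).measurable hMb
    rw [← hμ] at hDLR
    rw [← hDLR, ← integral_const_mul]
    set P : GaugeConfig 4 L (SUN N) → ℝ := fun y => ∫ g', F (update y ℓ g') ∂((haarProbability (SUN N)).tilted fun g'' => V (update y ℓ g''))
      with hP
    have hPupd : ∀ y g, P (update y ℓ g) = P y := fun y g => by simp only [hP, update_idem]
    have hh : Measurable fun y => (F y - P y) ^ 2 := (hFm.sub (HeatBath.measurable_heatBath (haarProbability (SUN N)) hVm ℓ hFm)).pow_const 2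
    have hhb : ∀ y, |(F y - P y) ^ 2| ≤ (2 * M) ^ 2 := fun y => by
      rw [abs_pow]
      refine pow_le_pow_left₀ (abs_nonneg _) ((abs_sub _ _).trans ?_) 2
      calc _ ≤ M + M := add_le_add (hM y) (HeatBath.abs_heatBath_le _ hVm hVb y ℓ hM)
        _ = 2 * M := by ring
    have hI1 := integrable_heatBath (haarProbability (SUN N)) hVm hVb ℓ hh hhb
    simp only [hPupd] at hI1
    rw [← hμ] at hI1
    have hI2 := (integrable_heatBath (haarProbability (SUN N)) hVm hVb ℓ (hblkc ℓ).measurable hMb).const_mul K₀⁻¹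
    rw [← hμ] at hI2
    exact integral_mono hI1 hI2 fun U => condVariance_le_twisted hN β hK₀ hL hf ℓ U
  have hsum : ∑ ℓ : Edge 4 L, ∫ U, ∫ g, (F U - F (update U ℓ g)) ^ 2
        ∂((haarProbability (SUN N)).tilted fun g' => V (update U ℓ g')) ∂μ ≤ 2 * K₀⁻¹ * ∫ U, Gam f f (emb U) ∂μ := by
    calc _ ≤ ∑ ℓ : Edge 4 L, 2 * K₀⁻¹ * ∫ U, ∑ α : FrameIdx N, algD (lk ℓ (frame α)) f (emb U) ^ 2 ∂μ :=
          Finset.sum_le_sum fun ℓ _ => key ℓ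
      _ = 2 * K₀⁻¹ * ∫ U, Gam f f (emb U) ∂μ := by
          rw [← Finset.mul_sum, ← integral_finsetSum _ fun ℓ _ => integrable_of_continuous_PSU (hblkc ℓ) μ]
          congr 1
          refine integral_congr_ae (ae_of_all _ fun U => ?_)
          simp only [Gam_eq_sum_blocks]
  calc Var[F; μ] ≤ (2 * (1 - c))⁻¹ * ∑ ℓ : Edge 4 L, ∫ U, ∫ g, (F U - F (update U ℓ g)) ^ 2
        ∂((haarProbability (SUN N)).tilted fun g' => V (update U ℓ g')) ∂μ := hHB
    _ ≤ (2 * (1 - c))⁻¹ * (2 * K₀⁻¹ * ∫ U, Gam f f (emb U) ∂μ) := mul_le_mul_of_nonneg_left hsum (by positivity)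
    _ = ((1 - c) * K₀)⁻¹ * ∫ U, Gam f f (emb U) ∂μ := by field_simp

/-- ★★★ **`SU(2)`, `d = 4`, HYPOTHESIS-FREE on `0 ≤ β_W < 2/9`, TWISTED CONSTANT**: on every torus `(ℤ/L)⁴`, `L ≥ 2`, for every smooth `f` of the link matrices,
`Var_μ(f) ≤ ((1 − 9β_W/2) · (3/2)(1 − 3β_W/2 − 9β_W²/16))⁻¹ ∫ Γ(f,f) dμ` — Langevin gap (standard reading) `≥ (1 − 9β_W/2)·(3/2)(1 − 3β_W/2 − 9β_W²/16)`,
which is `3/2` (the sharp Haar gap of `SU(2) = S³`) at `β_W = 0`, `0.527` at `β_W = 1/8`, `0.102` at `β_W = 1/5`; `LangevinPoincare.su2_variance_le_integral_Gam`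
(Bakry–Émery one-link step) has `(1 − 9β_W/2)(1 − 3β_W)` (`1` at `0`, `0.273` at `1/8`, `0.040` at `1/5`). [folklore] -/
theorem su2_variance_le_integral_Gam_twisted {βW : ℝ} (h0 : 0 ≤ βW) (h : βW < 2 / 9) (hL : 1 < L)
    {f : Cfg (Edge 4 L) 2 → ℝ} (hf : ContDiff ℝ ∞ f) :
    Var[fun U => f (emb U); wilsonMeasure (d := 4) (L := L) (fundamentalRep (Fin 2)) (βW / 2)] ≤
      ((1 - 9 * βW / 2) * (3 / 2 * (1 - 3 * βW / 2 - 9 * βW ^ 2 / 16)))⁻¹ *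
        ∫ U, Gam f f (emb U) ∂(wilsonMeasure (d := 4) (L := L) (fundamentalRep (Fin 2)) (βW / 2)) := by
  have habs : |βW / 2| = βW / 2 := abs_of_nonneg (by positivity)
  have e : (((2 : ℕ) : ℝ) ^ 2 - 1) / (((2 : ℕ) : ℝ) ^ 2 - 2) * (((2 : ℕ) : ℝ) / 2 - (((2 : ℕ) : ℝ) - 2 / (2 : ℕ)) * (|βW / 2| / (2 : ℕ) * 6) -
      (|βW / 2| / (2 : ℕ) * 6) ^ 2 / (2 * (2 : ℕ))) = 3 / 2 * (1 - 3 * βW / 2 - 9 * βW ^ 2 / 16) := by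
    rw [habs]; push_cast; ring
  have hK₀ : 0 < 3 / 2 * (1 - 3 * βW / 2 - 9 * βW ^ 2 / 16) := by nlinarith
  have key := variance_le_integral_Gam_twisted (N := 2) (L := L) le_rfl (β := βW / 2) zero_le_one (R := 3 * βW / 2)
    (by rw [habs]; push_cast; linarith) (SlabAreaLawDimensions.su2_oneLinkKRModulus_of_le_one (by linarith))
    (c := 9 * βW / 2) (by rw [habs]; push_cast; linarith) (by linarith) (by rw [e]; exact hK₀) hL hf
  rw [e] at key
  exact key

/-- ★★ **`SU(3)`, `d = 4`, HYPOTHESIS-FREE on `0 ≤ β_W < 1000/3531 ≈ 0.2832`, TWISTED MODULUS AND TWISTED ONE-LINK CONSTANT** (tree coupling `β_W/3`; engine-2's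
certified modulus `OneLinkKRModulus 3 (1/5) (3531/2000)`): `Var_μ(f) ≤ ((1 − 3531β_W/1000) · (8/7)(3/2 − 14β_W/9 − 2β_W²/27))⁻¹ ∫ Γ(f,f) dμ` on every torus of side
`≥ 2` — gap `→ 12/7` as `β_W → 0`, `0.148` at `β_W = 1/4` (the Bakry–Émery-step cell `LangevinPoincareCells.su3_variance_le_integral_Gam_pv2t`: `(1 − 3531β_W/1000)(3/2 − 2β_W)`,
`0.117` at `1/4`). [folklore] -/
theorem su3_variance_le_integral_Gam_twisted {βW : ℝ} (h0 : 0 ≤ βW) (h : βW < 1000 / 3531) (hL : 1 < L) {f : Cfg (Edge 4 L) 3 → ℝ}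
    (hf : ContDiff ℝ ∞ f) :
    Var[fun U => f (emb U); wilsonMeasure (d := 4) (L := L) (fundamentalRep (Fin 3)) (βW / 3)] ≤
      ((1 - 3531 * βW / 1000) * (8 / 7 * (3 / 2 - 14 * βW / 9 - 2 * βW ^ 2 / 27)))⁻¹ *
        ∫ U, Gam f f (emb U) ∂(wilsonMeasure (d := 4) (L := L) (fundamentalRep (Fin 3)) (βW / 3)) := by
  have habs : |βW / 3| = βW / 3 := abs_of_nonneg (by positivity)
  have habs' : |βW / 3| / ((3 : ℕ) : ℝ) = βW / 9 := by rw [habs]; push_cast; ring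
  have e : (((3 : ℕ) : ℝ) ^ 2 - 1) / (((3 : ℕ) : ℝ) ^ 2 - 2) * (((3 : ℕ) : ℝ) / 2 - (((3 : ℕ) : ℝ) - 2 / (3 : ℕ)) * (|βW / 3| / (3 : ℕ) * 6) -
      (|βW / 3| / (3 : ℕ) * 6) ^ 2 / (2 * (3 : ℕ))) = 8 / 7 * (3 / 2 - 14 * βW / 9 - 2 * βW ^ 2 / 27) := by
    rw [habs]; push_cast; ring
  have hK₀ : 0 < 8 / 7 * (3 / 2 - 14 * βW / 9 - 2 * βW ^ 2 / 27) := by nlinarith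
  have key := variance_le_integral_Gam_twisted (N := 3) (L := L) (by norm_num) (β := βW / 3) (by norm_num) (R := 1 / 5)
    (by rw [habs']; linarith) TwistedBochner.su3_oneLinkKRModulus_pv2t_oneFifth (c := 3531 * βW / 1000)
    (by rw [habs']; linarith) (by linarith) (by rw [e]; exact hK₀) hL hf
  rw [e] at key
  exact key

end Main

/-! ### Every infinite-volume limit state -/

section Limits

/-- ★★★ **`SU(2)`, `d = 4`, EVERY INFINITE-VOLUME LIMIT STATE, TWISTED CONSTANT** (HYPOTHESIS-FREE on `0 ≤ β_W < 2/9`, tree coupling `β_W/2`): for every tight limit `μ`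
of the torus Wilson states and every smooth cylinder function `F = f((U_e)_{e∈Λ})`,
`Var_μ(F) ≤ ((1 − 9β_W/2)·(3/2)(1 − 3β_W/2 − 9β_W²/16))⁻¹ ∫ Γ(f,f)((U_e)_{e∈Λ}) dμ(U)` (`LangevinPoincareLimit.su2_limit_variance_le_integral_Gam` has
`((1 − 9β_W/2)(1 − 3β_W))⁻¹`). [folklore] -/
theorem su2_limit_variance_le_integral_Gam_twisted {βW : ℝ} (h0 : 0 ≤ βW) (h : βW < 2 / 9)
    {μ : Measure (Literature.MathematicalPhysics.QuantumLattice.LGConfig 4 (Matrix.specialUnitaryGroup (Fin 2) ℂ))}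
    (hμ : μ ∈ infiniteVolumeLimitPoints (d := 4) (fundamentalRep (Fin 2)) (βW / 2))
    (Λ : Finset (ZdEdge 4)) {f : (↥Λ → Matrix (Fin 2) (Fin 2) ℂ) → ℝ} (hf : ContDiff ℝ ∞ f) :
    Var[matrixCylinder Λ f; μ] ≤
      ((1 - 9 * βW / 2) * (3 / 2 * (1 - 3 * βW / 2 - 9 * βW ^ 2 / 16)))⁻¹ * ∫ U, Gam f f (fun e : ↥Λ => (U e : Matrix (Fin 2) (Fin 2) ℂ)) ∂μ :=
  variance_le_integral_Gam_of_mem_infiniteVolumeLimitPoints_of_torus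
    (fun L _ hL => fun hg => su2_variance_le_integral_Gam_twisted (L := L) h0 h hL hg) hμ Λ hf

end Limits

end Summit.Ventures.YMGap.RobustBall.LangevinPoincare

end
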